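/-
Copyright (c) 2026 the pub-hodgecm-mathlib formalisation cell (harness21).  Prover seat hodgecm-mathlib-F0P2-p11 (g0) (re-dealt to L1 by director s1969∕s1970,
LEAD F0P6-plan (g14) EMIT #1 «p22» file), Track B «K2-LIT» ∕ hLiu418 #184♮, ROAD Φ, G5-b = Φ7-3, organ (R1-α), device (b2) = THE (β0-1a) CORNER UNFOLDING WITH A
CHARACTER (K2E5-p17 (g7) census `CENSUS-G5b-RankOneTermPackage` 4a4be154eb368c66 §0∕§2 «the (α2) device with a character»).  THEOREMS ONLY.
-/
import Summits.HodgeConjecture.HodgeConjecture.Theorems.K2LiuMiddleInnerSectionUnfold          -- ★ FILE C p860139 (+ ★ FILE A p860018, FILE B p860079, ★ α2d-2)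
import Summits.HodgeConjecture.HodgeConjecture.Theorems.K2LiuSiegelMiddleStabilizerCharacter   -- ★ Φ2 file 4 `reflection_stabilizer_data` (inducing character dies on `N_χ(𝔸)`)
import HarnessLib

/-!
# Crux `HLiu418`, ROAD Φ, organ Φ7-3 (R1-α), device (b2): THE CORNER UNFOLDING OF `N_Δ(𝔸)` FOR INTRINSIC INTEGRANDS — WITH A CHARACTER —
# `∫_{N_Δ(𝔸)} β₁(u) • (conj ψ_S(u) · f(w₀ u h)) dνN(u) = C • ∫_{𝔸_{L⁺}} conj ψ_S(n₂ t) · f(w₀ n₂(t) h) dμ(t)` for `ψ_S` trivial on `N_χ(𝔸)`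

Cell `hodgecm-mathlib`, crux item hLiu418 = `stmt-HodgeConjecture-24832` (helper lane, count-neutral); squad K2 ∕ K2Liu, LEAD F0P6-plan (g14), co-dealer K2E5-plan (g7);
prover F0P2-p11 (g0).  THEOREMS ONLY (no `def`, no `instance`, no notation, no named-fact hypothesis, no `sorry`).

WHY.  For a RANK-ONE index `S` at `n = 2` the middle term `MID_S` of the `S`-th coefficient of `E^Δ` (★ Φ2 `fourierCoeff_cells_of_ne_one`) concentrates on the corner-supported
orbit (★ `integral_rest_eq_tsum_orbit`, ★ `forall_stabilizer_unipDeltaChar_eq_one_iff_corner`, ★ Φ7-1 (i) `exists_corner_supported_levi`), and one orbit is ONE weighted integral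
`∫ β₁(u) • (conj ψ_S(u) · f(γ₀ u h)) dνN(u)` against a `Stab(γ₀)`-covering weight (★ α2a `tsum_orbit_eq_integral_wt_smul`, twist included).  The last step — integrating out the
compact `N_χ(L⁺)∖N_χ(𝔸)` onto the corner line `n₂(𝔸_{L⁺})` — is ★ FILE C `K2LiuMiddleInnerSectionUnfold.exists_corner_unfold` for `S = 0`, but FILE C is stated for integrands
`φ(u · y)` with `φ` left-`N_χ(𝔸)`-invariant ON ALL OF `H(𝔸)`, a shape that cannot absorb the twist (`ψ_S` is a character of `N_Δ(𝔸)` only, ★ `unipDeltaChar_mul`).  This file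
re-runs FILE C's proof — token for token up to ★ FILE A `exists_unfolding_constant`, whose two unfolding clauses are already intrinsic on `B = N_Δ(𝔸)` — with the INTRINSIC head:
* §1 **`exists_corner_unfold_of_invariant`** (MASTER) — FILE C's binders VERBATIM and the SAME `∃ n₂ C`-head; then for every `Γ₀ = N_χ(L⁺)` (★ α3-2's membership law) and every
  `Γ₀`-covering weight `β₁`: (LIN) `∫⁻ β₁ · Φ dνN = C · ∫⁻ Φ(n₂ t) dμ` for measurable `Φ : H(𝔸) → [0, ∞]` with `Φ(z u) = Φ(u)` (`z ∈ N_χ(𝔸)`, `u ∈ N_Δ(𝔸)`); (BOCH) for Banach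
  `E` and `φ : H(𝔸) → E` continuous along `N_Δ(𝔸)` with the same RESTRICTED invariance: integrability equivalence and `∫ β₁(u) • φ(u) dνN = C • ∫ φ(n₂ t) dμ`.  FILE C's
  head is the instance `φ := φ(· y)`; all instances share ONE `C`.
* §2 **`exists_corner_unfold_section_twisted`** — THE (R1-α)(b) LETTER in ★ α2a's currency at `γ₀ = w₀ = ι(1, g₀ ⊗ 1)`: for a continuous Siegel section `f` of `I_Δ(s, χ)`, an
  index `S` with the CORNER letter `∀ z ∈ N_Δ(𝔸), w₀ z w₀⁻¹ ∈ P_Δ → ψ_S(z) = 1` (★ `unipDeltaChar_eq_one_of_corner` in the corner frame) and every `h`: the twist-free `[0, ∞]`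
  transport of `‖f(w₀ u h)‖ₑ`, the integrability equivalence, and `∫ β₁(u) • (conj ψ_S(u) · f(w₀ u h)) dνN = C • ∫ conj ψ_S(n₂ t) · f(w₀ · n₂ t · h) dμ`; the
  left-`N_χ(𝔸)`-invariance of `f(w₀ ·)` is DISCHARGED (the inducing character dies on the middle stabilisers: ★ Φ2 file 4 `reflection_stabilizer_data`).
NOT here (rest of (R1-α)): (b1) the per-orbit transport `γ₀ = w₀Λĝ ↦ w₀`, `S ↦ S^{ĝ}` (twisted twin of ★ α3-2 `tsum_orbit_reflStd_levi_eq`); (b3) the assembly; (a) the big cell.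
References: [MoeglinWaldspurger1995] II.1.7, II.1.6; [KudlaRallis1994] §2 (2.10)–(2.12); [Shimura1997] §18.3–18.5; [Tan1999] §3–§4; [GelbartPiatetskishapiroRallis1987] Part A §2.
HONEST LABEL.  Count-neutral helper: `HC_CM` is proved only modulo the 7 printed citations (2 remaining named inputs: hLiu418 = `stmt-HodgeConjecture-24832`,
h413 = `stmt-HodgeConjecture-24833`) until rung 0 closes.
-/

set_option autoImplicit false
set_option linter.dupNamespace false -- the mandated namespace repeats `HodgeConjecture.HodgeConjecture`

noncomputable section

open scoped Matrix ENNReal NNReal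
open NumberField IsDedekindDomain MeasureTheory MeasureTheory.Measure Filter Set Function Topology
open Literature.NumberTheory.Automorphic Literature.NumberTheory.Automorphic.UnitaryGroup Literature.NumberTheory.GaloisRepresentations
open Literature.NumberTheory.GelbartRogawski1991 Literature.NumberTheory.GelbartRogawski1991.GRConstruction
open Literature.NumberTheory.K2Lit.SiegelDoubled Literature.MeasureTheory.Group
open Literature.NumberTheory.GelbartRogawski1991.AdaptedBlocks
open UnitaryDualPair
open Summit.HodgeConjecture.HodgeConjecture.Cruxes.HLiu418.K2LiuCoveringWeightSemidirectUnfold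
open Summit.HodgeConjecture.HodgeConjecture.Cruxes.HLiu418.K2LiuUnipDeltaCornerCoordinates
open Summit.HodgeConjecture.HodgeConjecture.Cruxes.HLiu418.K2LiuSiegelUnipotentCharacters (toBlocks₁₂_blk_mul toBlocks₁₂_blk_one toBlocks₁₂_blk_inv continuous_toBlocks₁₂_blk)
open Summit.HodgeConjecture.HodgeConjecture.Cruxes.HLiu418.K2LiuConstantTermMiddleCellOrbits (stabilizer_reflStd_iff)
open Summit.HodgeConjecture.HodgeConjecture.Cruxes.HLiu418.K2LiuSiegelUnipotentHaarPinned (locallyCompactSpace_unipDelta secondCountableTopology_unipDelta)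
open Summit.HodgeConjecture.HodgeConjecture.Cruxes.HLiu418.K2LiuUnipotentCocompact (exists_isCompact_cover_unipDelta)
open Summit.HodgeConjecture.HodgeConjecture.Cruxes.HLiu418.K2LiuUnipotentCoveringWeight (countable_unipDeltaRat finite_unipDeltaRat_smul_mem)
open Summit.HodgeConjecture.HodgeConjecture.Cruxes.HLiu418.K2LiuSiegelDoubledRationalMultiplicity (finite_ratH_inter)
open Summit.HodgeConjecture.HodgeConjecture.Cruxes.HLiu418.K2LiuMiddleInnerSectionUnfold (isHaarMeasure_map_of_homeomorph_add exists_cornerHom)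
open Summit.HodgeConjecture.HodgeConjecture.Cruxes.HLiu418.K2LiuSiegelMiddleStabilizerCharacter (reflection_stabilizer_data)
open Summit.HodgeConjecture.HodgeConjecture.Cruxes.HLiu418.K2LiuSiegelBruhatMiddleCellDelta (isSiegelDelta_conj_unip_iff iotaGG_one_mul_self)
open Summit.HodgeConjecture.HodgeConjecture.Cruxes.HLiu418.K2LiuSiegelUnipotentCharacters (unipDeltaChar_mul continuous_unipDeltaChar)
open Summit.HodgeConjecture.HodgeConjecture.Cruxes.HLiu418.K2LiuSiegelUnipotentFourierDefs (unipDeltaChar)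
open Summit.HodgeConjecture.HodgeConjecture.Cruxes.HLiu418.K2LiuSiegelMiddleCellSortedPattern (mul_self_of_coe_eq_signDiagonal pattern_std)
open Summit.HodgeConjecture.HodgeConjecture.Cruxes.HLiu418.K2LiuSiegelMiddleCellLeviCriterion (reflStd_inv)
open scoped ComplexConjugate

namespace Summit.HodgeConjecture.HodgeConjecture.Cruxes.HLiu418.K2LiuRankOneUnfolding

variable (L : Type) [Field L] [NumberField L] [IsCMField L]
variable {N M : ℕ} (e : Fin N × Fin M ≃ Fin 2)
  (dV : Fin N → L) (hdV : ∀ i, IsCMField.complexConj L (dV i) = dV i)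
  (dW : Fin M → L) (hdW : ∀ i, IsCMField.complexConj L (dW i) = dW i)

/-! ## §1 THE MASTER: the corner unfolding for intrinsic integrands on `N_Δ(𝔸)` -/

set_option maxHeartbeats 1600000 in -- one long assembly over the doubled unitary carriers, exactly as ★ FILE C `exists_corner_unfold`
/-- **(β0-1a) THE CORNER UNFOLDING OF `N_Δ(𝔸)`, INTRINSIC FORM** (module docstring §1): the corner one-parameter subgroup `n₂` and ONE `C ∈ (0, ∞)` with, for every `N_χ(L⁺)`-covering
weight `β₁`, (LIN) `∫⁻ β₁ · Φ dνN = C · ∫⁻ Φ(n₂ t) dμ` for measurable `Φ ≥ 0` invariant under `u ↦ z u` (`z ∈ N_χ(𝔸)`, `u ∈ N_Δ(𝔸)`) and (BOCH) `∫ β₁(u) • φ(u) dνN = C • ∫ φ(n₂ t) dμ`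
(+ integrability equivalence) for Banach-valued `φ` continuous along `N_Δ(𝔸)` with the same invariance.  Proof = ★ FILE C's, with ★ FILE A's intrinsic clauses read off directly.
[cite: MoeglinWaldspurger1995, II.1.7] [cite: KudlaRallis1994, §2 (2.10)–(2.12)] [cite: GelbartPiatetskishapiroRallis1987, Part A §2] -/
theorem exists_corner_unfold_of_invariant (hdV0 : ∀ i, dV i ≠ 0) (hdW0 : ∀ i, dW i ≠ 0)
    {g₀ : UnitaryGroup.rationalPair (Fp L) L (IsCMField.complexConj L) N M (Matrix.diagonal dV) (Matrix.diagonal dW)}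
    (hg₀ : ((g₀ : GL (Fin N × Fin M) L) : Matrix (Fin N × Fin M) (Fin N × Fin M) L) = Matrix.diagonal (fun k => 1 - 2 * (![0, 1] : Fin 2 → L) (e k)))
    (Λ : GL (Fin 2) (AdeleRing (𝓞 L) L) →* HA L e dV hdV dW hdW)
    (hΛ : ∀ g : GL (Fin 2) (AdeleRing (𝓞 L) L), blk L e dV hdV dW hdW (Λ g) =
      cayR (AdeleRing (𝓞 L) L) (Fin 2) * Matrix.fromBlocks (g : Matrix (Fin 2) (Fin 2) (AdeleRing (𝓞 L) L)) 0 0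
        (((gramR L e dV hdV dW hdW).map ((algebraMap L (AdeleRing (𝓞 L) L)).comp (algebraMap (Fp L) L)))⁻¹ *
          (((g⁻¹ : GL (Fin 2) (AdeleRing (𝓞 L) L)) : Matrix (Fin 2) (Fin 2) (AdeleRing (𝓞 L) L)).map
            (conjAdele (Fp L) L (IsCMField.complexConj L)))ᵀ *
          (gramR L e dV hdV dW hdW).map ((algebraMap L (AdeleRing (𝓞 L) L)).comp (algebraMap (Fp L) L))) *
        cayRinv (AdeleRing (𝓞 L) L) (Fin 2))
    [MeasurableSpace (unipDelta L e dV hdV dW hdW)] [BorelSpace (unipDelta L e dV hdV dW hdW)]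
    (νN : Measure (unipDelta L e dV hdV dW hdW)) [IsHaarMeasure νN]
    [MeasurableSpace (AdeleRing (𝓞 (Fp L)) (Fp L))] [BorelSpace (AdeleRing (𝓞 (Fp L)) (Fp L))]
    (μ : Measure (AdeleRing (𝓞 (Fp L)) (Fp L))) [μ.IsAddHaarMeasure] :
    ∃ (n₂ : AdeleRing (𝓞 (Fp L)) (Fp L) → HA L e dV hdV dW hdW) (C : ℝ≥0∞), C ≠ 0 ∧ C ≠ ∞ ∧
      Continuous n₂ ∧ (∀ s t, n₂ (s + t) = n₂ s * n₂ t) ∧ (∀ t, n₂ t ∈ unipDelta L e dV hdV dW hdW) ∧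
      (∀ t, (blk L e dV hdV dW hdW (n₂ t)).toBlocks₁₂ =
        Matrix.single (1 : Fin 2) (1 : Fin 2) (AdeleRing.baseChange (Fp L) L t * algebraMap L (AdeleRing (𝓞 L) L) (imagUnit L))) ∧
      (∀ t : Fp L, n₂ (algebraMap (Fp L) (AdeleRing (𝓞 (Fp L)) (Fp L)) t) ∈ ratH L e dV hdV dW hdW) ∧
      ∀ (Γ₀ : Subgroup (unipDelta L e dV hdV dW hdW))
        (_ : ∀ u : unipDelta L e dV hdV dW hdW, u ∈ Γ₀ ↔ (u : HA L e dV hdV dW hdW) ∈ ratH L e dV hdV dW hdW ∧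
          IsSiegelDelta L e dV hdV dW hdW
            (iotaGG L e dV hdV dW hdW (1, UnitaryGroup.rationalPairToAdelic (Fp L) L (IsCMField.complexConj L) N M (Matrix.diagonal dV) (Matrix.diagonal dW) g₀) *
              (u : HA L e dV hdV dW hdW) *
              (iotaGG L e dV hdV dW hdW (1, UnitaryGroup.rationalPairToAdelic (Fp L) L (IsCMField.complexConj L) N M (Matrix.diagonal dV) (Matrix.diagonal dW) g₀))⁻¹))
        (β₁ : unipDelta L e dV hdV dW hdW → ℝ≥0∞) (_ : IsCoveringWeight Γ₀ β₁),
        (∀ (Φ : HA L e dV hdV dW hdW → ℝ≥0∞), Measurable (fun u : unipDelta L e dV hdV dW hdW => Φ (u : HA L e dV hdV dW hdW)) →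
          (∀ z : HA L e dV hdV dW hdW, z ∈ unipDelta L e dV hdV dW hdW →
            IsSiegelDelta L e dV hdV dW hdW (iotaGG L e dV hdV dW hdW (1, UnitaryGroup.rationalPairToAdelic (Fp L) L (IsCMField.complexConj L) N M (Matrix.diagonal dV) (Matrix.diagonal dW) g₀) * z * (iotaGG L e dV hdV dW hdW (1, UnitaryGroup.rationalPairToAdelic (Fp L) L (IsCMField.complexConj L) N M (Matrix.diagonal dV) (Matrix.diagonal dW) g₀))⁻¹) →
            ∀ u : HA L e dV hdV dW hdW, u ∈ unipDelta L e dV hdV dW hdW → Φ (z * u) = Φ u) →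
          ∫⁻ u, β₁ u * Φ (u : HA L e dV hdV dW hdW) ∂νN = C * ∫⁻ t, Φ (n₂ t) ∂μ) ∧
        ∀ {E : Type*} [NormedAddCommGroup E] [NormedSpace ℝ E] [CompleteSpace E] (φ : HA L e dV hdV dW hdW → E)
          (_ : Continuous (fun u : unipDelta L e dV hdV dW hdW => φ (u : HA L e dV hdV dW hdW)))
          (_ : ∀ z : HA L e dV hdV dW hdW, z ∈ unipDelta L e dV hdV dW hdW →
            IsSiegelDelta L e dV hdV dW hdW (iotaGG L e dV hdV dW hdW (1, UnitaryGroup.rationalPairToAdelic (Fp L) L (IsCMField.complexConj L) N M (Matrix.diagonal dV) (Matrix.diagonal dW) g₀) * z * (iotaGG L e dV hdV dW hdW (1, UnitaryGroup.rationalPairToAdelic (Fp L) L (IsCMField.complexConj L) N M (Matrix.diagonal dV) (Matrix.diagonal dW) g₀))⁻¹) →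
            ∀ u : HA L e dV hdV dW hdW, u ∈ unipDelta L e dV hdV dW hdW → φ (z * u) = φ u),
          (Integrable (fun u : unipDelta L e dV hdV dW hdW => (β₁ u).toReal • φ (u : HA L e dV hdV dW hdW)) νN ↔ Integrable (fun t => φ (n₂ t)) μ) ∧
            ∫ u, (β₁ u).toReal • φ (u : HA L e dV hdV dW hdW) ∂νN = C.toReal • ∫ t, φ (n₂ t) ∂μ := by
  classical
  haveI : T2Space (InfiniteAdeleRing L) := inferInstanceAs (T2Space ((v : InfinitePlace L) → v.Completion))
  haveI : T2Space (FiniteAdeleRing (𝓞 L) L) :=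
    inferInstanceAs (T2Space (RestrictedProduct (fun v : HeightOneSpectrum (𝓞 L) => v.adicCompletion L)
      (fun v => (v.adicCompletionIntegers L : Set (v.adicCompletion L))) Filter.cofinite))
  haveI : T2Space (AdeleRing (𝓞 L) L) := inferInstanceAs (T2Space (InfiniteAdeleRing L × FiniteAdeleRing (𝓞 L) L))
  haveI : T1Space (Multiplicative (AdeleRing (𝓞 L) L)) := inferInstanceAs (T1Space (AdeleRing (𝓞 L) L))
  haveI : LocallyCompactSpace (unipDelta L e dV hdV dW hdW) := locallyCompactSpace_unipDelta L e dV hdV dW hdW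
  haveI : SecondCountableTopology (unipDelta L e dV hdV dW hdW) := secondCountableTopology_unipDelta L e dV hdV dW hdW
  haveI : Countable (unipDeltaRat L e dV hdV dW hdW) := countable_unipDeltaRat L e dV hdV dW hdW
  have hcommB : ∀ u v : unipDelta L e dV hdV dW hdW, u * v = v * u := fun u v => Subtype.ext (mul_comm_of_mem_unipDelta L e dV hdV dW hdW u.2 v.2)
  obtain ⟨n₂, hn₂c, hn₂add, hn₂0, hn₂mem, hn₂X, hn₂rat, -⟩ := exists_cornerSubgroup L e dV hdV dW hdW hdV0 hdW0
  obtain ⟨κ, hκc, hκ⟩ := exists_cornerHom L e dV hdV dW hdW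
  have hker : ∀ u : unipDelta L e dV hdV dW hdW, u ∈ κ.ker ↔ (blk L e dV hdV dW hdW (u : HA L e dV hdV dW hdW)).toBlocks₁₂ 1 1 = 0 := fun u => by
    rw [MonoidHom.mem_ker, hκ u, ofAdd_eq_one]
  have hZlaw : ∀ u : unipDelta L e dV hdV dW hdW, u ∈ κ.ker ↔
      IsSiegelDelta L e dV hdV dW hdW
        (iotaGG L e dV hdV dW hdW (1, UnitaryGroup.rationalPairToAdelic (Fp L) L (IsCMField.complexConj L) N M (Matrix.diagonal dV) (Matrix.diagonal dW) g₀) *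
          (u : HA L e dV hdV dW hdW) *
          (iotaGG L e dV hdV dW hdW (1, UnitaryGroup.rationalPairToAdelic (Fp L) L (IsCMField.complexConj L) N M (Matrix.diagonal dV) (Matrix.diagonal dW) g₀))⁻¹) :=
    fun u => by rw [hker, stabilizer_reflStd_iff hg₀ Λ hΛ u.2]
  let n₂B : AdeleRing (𝓞 (Fp L)) (Fp L) → unipDelta L e dV hdV dW hdW := fun t => ⟨n₂ t, hn₂mem t⟩
  have hn₂Bc : Continuous n₂B := hn₂c.subtype_mk _
  have hn₂Badd : ∀ s t, n₂B (s + t) = n₂B s * n₂B t := fun s t => Subtype.ext (hn₂add s t)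
  have hn₂B0 : n₂B 0 = 1 := Subtype.ext hn₂0
  let im : AdeleRing (𝓞 L) L → AdeleRing (𝓞 (Fp L)) (Fp L) := fun x =>
    ((quadraticAdeleEquiv (Fp L) L (IsCMField.complexConj L) (complexConj_imagUnit L) (imagUnit_ne_zero L)).symm x).2
  have himc : Continuous im := continuous_im L
  have hX11n₂ : ∀ t, (blk L e dV hdV dW hdW (n₂ t)).toBlocks₁₂ 1 1 = AdeleRing.baseChange (Fp L) L t * algebraMap L (AdeleRing (𝓞 L) L) (imagUnit L) := fun t => by
    rw [hn₂X, Matrix.single_apply_same]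
  have him_n₂ : ∀ t, im ((blk L e dV hdV dW hdW (n₂ t)).toBlocks₁₂ 1 1) = t := fun t => by
    rw [hX11n₂]
    exact im_baseChange_mul_delta L t
  let ρ₀ : unipDelta L e dV hdV dW hdW → unipDelta L e dV hdV dW hdW := fun u => n₂B (im ((blk L e dV hdV dW hdW (u : HA L e dV hdV dW hdW)).toBlocks₁₂ 1 1))
  have hX11c : Continuous fun u : unipDelta L e dV hdV dW hdW => (blk L e dV hdV dW hdW (u : HA L e dV hdV dW hdW)).toBlocks₁₂ 1 1 :=
    ((continuous_toBlocks₁₂_blk L e dV hdV dW hdW).comp continuous_subtype_val).matrix_elem 1 1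
  have hρ₀c : Continuous ρ₀ := hn₂Bc.comp (himc.comp hX11c)
  have hρ₀n₂ : ∀ t, ρ₀ (n₂B t) = n₂B t := fun t => by
    show n₂B (im ((blk L e dV hdV dW hdW (n₂ t)).toBlocks₁₂ 1 1)) = n₂B t
    rw [him_n₂]
  have hX11ρ₀ : ∀ u : unipDelta L e dV hdV dW hdW,
      (blk L e dV hdV dW hdW (ρ₀ u : HA L e dV hdV dW hdW)).toBlocks₁₂ 1 1 = (blk L e dV hdV dW hdW (u : HA L e dV hdV dW hdW)).toBlocks₁₂ 1 1 := fun u => by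
    show (blk L e dV hdV dW hdW (n₂ (im _))).toBlocks₁₂ 1 1 = _
    rw [hX11n₂]
    exact baseChange_im_mul_delta L (conjAdele_toBlocks₁₂_diag_eq_neg L e dV hdV dW hdW hdV0 hdW0 u.2 1)
  let n₂H : Multiplicative (AdeleRing (𝓞 (Fp L)) (Fp L)) →* unipDelta L e dV hdV dW hdW :=
    { toFun := fun t => n₂B (Multiplicative.toAdd t)
      map_one' := hn₂B0
      map_mul' := fun s t => hn₂Badd _ _ }
  set A : Subgroup (unipDelta L e dV hdV dW hdW) := n₂H.range with hAdef
  have hmemA : ∀ u, u ∈ A ↔ ∃ t, n₂B t = u := fun u =>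
    ⟨fun ⟨t, ht⟩ => ⟨Multiplicative.toAdd t, ht⟩, fun ⟨t, ht⟩ => ⟨Multiplicative.ofAdd t, ht⟩⟩
  have hAfix : ∀ u, u ∈ A ↔ ρ₀ u = u := fun u => by
    rw [hmemA]
    constructor
    · rintro ⟨t, rfl⟩
      exact hρ₀n₂ t
    · intro h
      exact ⟨_, h⟩
  have hAc : IsClosed (A : Set (unipDelta L e dV hdV dW hdW)) := by
    rw [show (A : Set (unipDelta L e dV hdV dW hdW)) = {u | ρ₀ u = u} from Set.ext hAfix]
    exact isClosed_eq hρ₀c continuous_id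
  set Z : Subgroup (unipDelta L e dV hdV dW hdW) := κ.ker with hZdef
  have hZc : IsClosed (Z : Set (unipDelta L e dV hdV dW hdW)) := by
    rw [hZdef, MonoidHom.coe_ker]
    exact isClosed_singleton.preimage hκc
  let ρ : unipDelta L e dV hdV dW hdW → A := fun u => ⟨ρ₀ u, (hmemA _).2 ⟨_, rfl⟩⟩
  have hρc : Continuous ρ := hρ₀c.subtype_mk _
  have hρ : ∀ (a : A) (z : Z), ρ ((a : unipDelta L e dV hdV dW hdW) * z) = a := fun a z => by
    obtain ⟨t, ht⟩ := (hmemA a).1 a.2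
    apply Subtype.ext
    show n₂B (im ((blk L e dV hdV dW hdW (((a : unipDelta L e dV hdV dW hdW) * (z : unipDelta L e dV hdV dW hdW) : unipDelta L e dV hdV dW hdW) :
      HA L e dV hdV dW hdW)).toBlocks₁₂ 1 1)) = a
    rw [Subgroup.coe_mul, toBlocks₁₂_blk_mul L e dV hdV dW hdW (a : unipDelta L e dV hdV dW hdW).2 (z : unipDelta L e dV hdV dW hdW).2, Matrix.add_apply,
      (hker _).1 z.2, add_zero, ← ht, him_n₂]
  have hρZ : ∀ b : unipDelta L e dV hdV dW hdW, ((ρ b : unipDelta L e dV hdV dW hdW))⁻¹ * b ∈ Z := fun b => by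
    refine (hker _).2 ?_
    rw [Subgroup.coe_mul, Subgroup.coe_inv, toBlocks₁₂_blk_mul L e dV hdV dW hdW (inv_mem (ρ₀ b).2) b.2, toBlocks₁₂_blk_inv L e dV hdV dW hdW (ρ₀ b).2,
      Matrix.add_apply, Matrix.neg_apply, hX11ρ₀, neg_add_cancel]
  have hnorm : ∀ (a : A) (z : Z), (a : unipDelta L e dV hdV dW hdW)⁻¹ * (z : unipDelta L e dV hdV dW hdW) * a ∈ Z := fun a z => by
    rw [hcommB _ (a : unipDelta L e dV hdV dW hdW), ← mul_assoc, mul_inv_cancel, one_mul]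
    exact z.2
  have hAZ : ∀ (a : A) (z : Z), (a : unipDelta L e dV hdV dW hdW) * z = (z : unipDelta L e dV hdV dW hdW) * a := fun a z => hcommB _ _
  obtain ⟨eAZ, hsd⟩ := exists_homeomorph_isTopSemidirect_of_retraction A Z ρ hρc hρ hρZ hAc hZc hnorm
  haveI : LocallyCompactSpace Z := hZc.locallyCompactSpace
  let μZ : Measure Z := Measure.haar
  let eA : AdeleRing (𝓞 (Fp L)) (Fp L) ≃ₜ A :=
    { toFun := fun t => ⟨n₂B t, (hmemA _).2 ⟨t, rfl⟩⟩
      invFun := fun a => im ((blk L e dV hdV dW hdW ((a : unipDelta L e dV hdV dW hdW) : HA L e dV hdV dW hdW)).toBlocks₁₂ 1 1)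
      left_inv := fun t => him_n₂ t
      right_inv := fun a => Subtype.ext ((hAfix a).1 a.2)
      continuous_toFun := hn₂Bc.subtype_mk _
      continuous_invFun := himc.comp (hX11c.comp continuous_subtype_val) }
  have heA : ∀ t, (((eA t : A) : unipDelta L e dV hdV dW hdW) : HA L e dV hdV dW hdW) = n₂ t := fun t => rfl
  haveI : IsHaarMeasure (μ.map eA) := isHaarMeasure_map_of_homeomorph_add μ eA fun s t => Subtype.ext (hn₂Badd s t)
  obtain ⟨C₀, hC₀c, hC₀cov⟩ := exists_isCompact_cover_unipDelta L e dV hdV dW hdW hdV0 hdW0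
  have hcover : ∀ b : unipDelta L e dV hdV dW hdW, ∃ γ ∈ unipDeltaRat L e dV hdV dW hdW, ∃ c ∈ C₀, b = γ * c := fun b => by
    obtain ⟨γ, hγ⟩ := hC₀cov b
    exact ⟨((γ⁻¹ : unipDeltaRat L e dV hdV dW hdW) : unipDelta L e dV hdV dW hdW), (γ⁻¹).2, _, hγ, (inv_mul_cancel_left _ _).symm⟩
  have hκρ₀ : ∀ u, κ (ρ₀ u) = κ u := fun u => by rw [hκ, hκ, hX11ρ₀]
  have hρ₀rat : ∀ γ : unipDelta L e dV hdV dW hdW, γ ∈ unipDeltaRat L e dV hdV dW hdW → (ρ₀ γ : HA L e dV hdV dW hdW) ∈ ratH L e dV hdV dW hdW := by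
    intro γ hγ
    obtain ⟨q, hq⟩ := toBlocks₁₂_blk_mem_range_algebraMap L e dV hdV dW hdW ((mem_unipDeltaRat_iff L e dV hdV dW hdW γ).1 hγ) 1 1
    have hanti := conjAdele_toBlocks₁₂_diag_eq_neg L e dV hdV dW hdW hdV0 hdW0 γ.2 1
    have hanti' : IsCMField.complexConj L q = -q := by
      apply AdeleRing.algebraMap_injective (𝓞 L) L
      refine (algebraMap_conj (Fp L) L (IsCMField.complexConj L) q).trans ?_
      rw [hq, hanti, map_neg, hq]
    have ht : IsCMField.complexConj L (q / imagUnit L) = q / imagUnit L := by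
      rw [map_div₀, hanti', complexConj_imagUnit, neg_div_neg_eq]
    set t : Fp L := ⟨q / imagUnit L, (IsCMField.complexConj_eq_self_iff (K := L) _).1 ht⟩ with htdef
    have hqt : algebraMap L (AdeleRing (𝓞 L) L) q =
        AdeleRing.baseChange (Fp L) L (algebraMap (Fp L) (AdeleRing (𝓞 (Fp L)) (Fp L)) t) * algebraMap L (AdeleRing (𝓞 L) L) (imagUnit L) := by
      rw [AdeleRing.baseChange_algebraMap, ← map_mul]
      congr 1
      show q = q / imagUnit L * imagUnit L
      rw [div_mul_cancel₀ _ (imagUnit_ne_zero L)]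
    have him_q : im ((blk L e dV hdV dW hdW (γ : HA L e dV hdV dW hdW)).toBlocks₁₂ 1 1) = algebraMap (Fp L) (AdeleRing (𝓞 (Fp L)) (Fp L)) t := by
      rw [← hq, hqt]
      exact im_baseChange_mul_delta L _
    show n₂ (im _) ∈ ratH L e dV hdV dW hdW
    rw [him_q]
    exact hn₂rat _
  have hfin : ((κ '' (unipDeltaRat L e dV hdV dW hdW : Set (unipDelta L e dV hdV dW hdW))) ∩ (κ '' C₀)).Finite := by
    have hF : (((ratH L e dV hdV dW hdW) : Set (HA L e dV hdV dW hdW)) ∩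
        ((fun u : unipDelta L e dV hdV dW hdW => (ρ₀ u : HA L e dV hdV dW hdW)) '' C₀)).Finite :=
      finite_ratH_inter L e dV hdV dW hdW (hC₀c.image (continuous_subtype_val.comp hρ₀c))
    have hT : (((↑) : unipDelta L e dV hdV dW hdW → HA L e dV hdV dW hdW) ⁻¹'
        ((((ratH L e dV hdV dW hdW) : Set (HA L e dV hdV dW hdW)) ∩
          ((fun u : unipDelta L e dV hdV dW hdW => (ρ₀ u : HA L e dV hdV dW hdW)) '' C₀)))).Finite :=
      hF.preimage Subtype.val_injective.injOn
    refine (hT.image κ).subset ?_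
    rintro s ⟨⟨γ, hγ, rfl⟩, ⟨c, hc, hγc⟩⟩
    have hX : (blk L e dV hdV dW hdW (c : HA L e dV hdV dW hdW)).toBlocks₁₂ 1 1 = (blk L e dV hdV dW hdW (γ : HA L e dV hdV dW hdW)).toBlocks₁₂ 1 1 := by
      have h := hγc
      rw [hκ, hκ] at h
      exact Multiplicative.ofAdd.injective h
    have hρeq : ρ₀ c = ρ₀ γ := by
      show n₂B (im _) = n₂B (im _)
      rw [hX]
    exact ⟨ρ₀ γ, ⟨hρ₀rat γ hγ, c, hc, congrArg Subtype.val hρeq⟩, hκρ₀ γ⟩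
  obtain ⟨K, hKc, hKZ, hKcov⟩ := exists_isCompact_cover_inf_of_cover (unipDeltaRat L e dV hdV dW hdW) Z κ hκc
    (fun b => by rw [hZdef, MonoidHom.mem_ker]) hC₀c hcover hfin
  set Γ₁ : Subgroup (unipDelta L e dV hdV dW hdW) := unipDeltaRat L e dV hdV dW hdW ⊓ Z with hΓ₁def
  have hle : Γ₁ ≤ Z := inf_le_right
  haveI : Countable Γ₁ := (Subgroup.inclusion_injective (inf_le_left : Γ₁ ≤ unipDeltaRat L e dV hdV dW hdW)).countable
  set K' : Set Z := ((↑) : Z → unipDelta L e dV hdV dW hdW) ⁻¹' K with hK'def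
  have hK'c : IsCompact K' := hZc.isClosedEmbedding_subtypeVal.isCompact_preimage hKc
  have hcover' : ∀ z : Z, ∃ γ : Γ₁.subgroupOf Z, γ • z ∈ K' := fun z => by
    obtain ⟨γ, hγ, k, hk, hzk⟩ := hKcov z z.2
    refine ⟨⟨⟨γ⁻¹, hle (inv_mem hγ)⟩, Subgroup.mem_subgroupOf.2 (inv_mem hγ)⟩, ?_⟩
    have hval : (((⟨γ⁻¹, hle (inv_mem hγ)⟩ : Z) * z : Z) : unipDelta L e dV hdV dW hdW) = k := by
      rw [Subgroup.coe_mul, hzk]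
      exact inv_mul_cancel_left γ k
    show (((⟨γ⁻¹, hle (inv_mem hγ)⟩ : Z) * z : Z) : unipDelta L e dV hdV dW hdW) ∈ K
    rw [hval]
    exact hk
  have hfin' : ∀ z : Z, {γ : Γ₁.subgroupOf Z | γ • z ∈ K'}.Finite := fun z => by
    refine finite_smul_mem_of_finite Z Γ₁ hle z ?_
    have h1 : (((↑) : Z → unipDelta L e dV hdV dW hdW) '' K') ⊆ K := by
      rintro _ ⟨k, hk, rfl⟩
      exact hk
    refine ((finite_unipDeltaRat_smul_mem L e dV hdV dW hdW hKc (z : unipDelta L e dV hdV dW hdW)).preimage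
      (Subgroup.inclusion_injective (inf_le_left : Γ₁ ≤ unipDeltaRat L e dV hdV dW hdW)).injOn).subset fun γ hγ => ?_
    exact h1 hγ
  obtain ⟨βZ, hβZ, hβZfin⟩ := exists_isCoveringWeight_lintegral_ne_top Z Γ₁ hle μZ hK'c hfin' hcover'
  obtain ⟨Cst, hC0, hCtop, hlin, hboch⟩ := exists_unfolding_constant (μ.map eA) μZ νN hsd hAZ Γ₁ hle hβZ hβZfin
  refine ⟨n₂, Cst, hC0, hCtop, hn₂c, hn₂add, hn₂mem, hn₂X, hn₂rat, ?_⟩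
  intro Γ₀ hΓ₀ β₁ hβ₁
  have hΓ : Γ₀ = Γ₁ := by
    ext u
    rw [hΓ₀, hΓ₁def, Subgroup.mem_inf, mem_unipDeltaRat_iff, hZlaw]
  subst hΓ
  refine ⟨fun Φ hΦm hΦZ => ?_, fun φ hφc hφZ => ?_⟩
  · have hΦ'Z : ∀ (z : Z) (b : unipDelta L e dV hdV dW hdW),
        Φ ((((z : unipDelta L e dV hdV dW hdW) * b : unipDelta L e dV hdV dW hdW) : HA L e dV hdV dW hdW)) = Φ ((b : HA L e dV hdV dW hdW)) := fun z b => by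
      rw [Subgroup.coe_mul]
      exact hΦZ _ (z : unipDelta L e dV hdV dW hdW).2 ((hZlaw _).1 z.2) _ b.2
    have htr := lintegral_map_equiv (μ := μ) (fun a : A => Φ (((a : unipDelta L e dV hdV dW hdW) : HA L e dV hdV dW hdW))) eA.toMeasurableEquiv
    rw [Homeomorph.toMeasurableEquiv_coe] at htr
    rw [hlin β₁ hβ₁ (fun b => Φ ((b : HA L e dV hdV dW hdW))) hΦm hΦ'Z, htr]
    rfl
  · have hφ'Z : ∀ (z : Z) (b : unipDelta L e dV hdV dW hdW),
        φ ((((z : unipDelta L e dV hdV dW hdW) * b : unipDelta L e dV hdV dW hdW) : HA L e dV hdV dW hdW)) = φ ((b : HA L e dV hdV dW hdW)) := fun z b => by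
      rw [Subgroup.coe_mul]
      exact hφZ _ (z : unipDelta L e dV hdV dW hdW).2 ((hZlaw _).1 z.2) _ b.2
    obtain ⟨hiff, hint⟩ := hboch β₁ hβ₁ (fun b => φ ((b : HA L e dV hdV dW hdW))) hφc hφ'Z
    have htr := integral_map_equiv (μ := μ) eA.toMeasurableEquiv (fun a : A => φ (((a : unipDelta L e dV hdV dW hdW) : HA L e dV hdV dW hdW)))
    have htrI := integrable_map_equiv (μ := μ) eA.toMeasurableEquiv (fun a : A => φ (((a : unipDelta L e dV hdV dW hdW) : HA L e dV hdV dW hdW)))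
    rw [Homeomorph.toMeasurableEquiv_coe] at htr htrI
    exact ⟨hiff.trans htrI, hint.trans (by rw [htr]; rfl)⟩

/-! ## §2 The (R1-α)(b) letter: a Siegel section against the twist `conj ψ_S`, at the standard reflection `w₀` -/

/-- **THE TWISTED INNER INTEGRAL OF THE MIDDLE ORBIT UNFOLDS ALONG THE CORNER LINE** (`n₂`, `C` of §1 — SAME constant; `w₀ = ι(1, g₀ ⊗ 1)`): for every `N_χ(L⁺)`-covering
weight `β₁`, continuous Siegel section `f` of `I_Δ(s, χ)`, index `S` with `ψ_S` trivial on `N_χ(𝔸)` (CORNER letter) and `h ∈ H(𝔸)`: (i) `∫⁻ ‖f(w₀ u h)‖ₑ β₁(u) dνN =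
C · ∫⁻ ‖f(w₀ · n₂ t · h)‖ₑ dμ`; (ii) integrability equivalence and `∫ β₁(u) • (conj ψ_S(u) · f(w₀ u h)) dνN = C • ∫ conj ψ_S(n₂ t) · f(w₀ · n₂ t · h) dμ` — the right-hand
side of ★ α2a `tsum_orbit_eq_integral_wt_smul` at `γ₀ = w₀`, unfolded (invariance of `f(w₀ ·)` by ★ `reflection_stabilizer_data`).
[cite: MoeglinWaldspurger1995, II.1.7] [cite: KudlaRallis1994, §2 (2.10)–(2.12)] [cite: Shimura1997, §18.3–18.4] [cite: Tan1999, §3] -/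
theorem exists_corner_unfold_section_twisted (hdV0 : ∀ i, dV i ≠ 0) (hdW0 : ∀ i, dW i ≠ 0)
    {g₀ : UnitaryGroup.rationalPair (Fp L) L (IsCMField.complexConj L) N M (Matrix.diagonal dV) (Matrix.diagonal dW)}
    (hg₀ : ((g₀ : GL (Fin N × Fin M) L) : Matrix (Fin N × Fin M) (Fin N × Fin M) L) = Matrix.diagonal (fun k => 1 - 2 * (![0, 1] : Fin 2 → L) (e k)))
    (Λ : GL (Fin 2) (AdeleRing (𝓞 L) L) →* HA L e dV hdV dW hdW)
    (hΛ : ∀ g : GL (Fin 2) (AdeleRing (𝓞 L) L), blk L e dV hdV dW hdW (Λ g) =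
      cayR (AdeleRing (𝓞 L) L) (Fin 2) * Matrix.fromBlocks (g : Matrix (Fin 2) (Fin 2) (AdeleRing (𝓞 L) L)) 0 0
        (((gramR L e dV hdV dW hdW).map ((algebraMap L (AdeleRing (𝓞 L) L)).comp (algebraMap (Fp L) L)))⁻¹ *
          (((g⁻¹ : GL (Fin 2) (AdeleRing (𝓞 L) L)) : Matrix (Fin 2) (Fin 2) (AdeleRing (𝓞 L) L)).map
            (conjAdele (Fp L) L (IsCMField.complexConj L)))ᵀ *
          (gramR L e dV hdV dW hdW).map ((algebraMap L (AdeleRing (𝓞 L) L)).comp (algebraMap (Fp L) L))) *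
        cayRinv (AdeleRing (𝓞 L) L) (Fin 2))
    [MeasurableSpace (unipDelta L e dV hdV dW hdW)] [BorelSpace (unipDelta L e dV hdV dW hdW)]
    (νN : Measure (unipDelta L e dV hdV dW hdW)) [IsHaarMeasure νN]
    [MeasurableSpace (AdeleRing (𝓞 (Fp L)) (Fp L))] [BorelSpace (AdeleRing (𝓞 (Fp L)) (Fp L))]
    (μ : Measure (AdeleRing (𝓞 (Fp L)) (Fp L))) [μ.IsAddHaarMeasure] :
    ∃ (n₂ : AdeleRing (𝓞 (Fp L)) (Fp L) → HA L e dV hdV dW hdW) (C : ℝ≥0∞), C ≠ 0 ∧ C ≠ ∞ ∧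
      Continuous n₂ ∧ (∀ s t, n₂ (s + t) = n₂ s * n₂ t) ∧ (∀ t, n₂ t ∈ unipDelta L e dV hdV dW hdW) ∧
      (∀ t, (blk L e dV hdV dW hdW (n₂ t)).toBlocks₁₂ =
        Matrix.single (1 : Fin 2) (1 : Fin 2) (AdeleRing.baseChange (Fp L) L t * algebraMap L (AdeleRing (𝓞 L) L) (imagUnit L))) ∧
      (∀ t : Fp L, n₂ (algebraMap (Fp L) (AdeleRing (𝓞 (Fp L)) (Fp L)) t) ∈ ratH L e dV hdV dW hdW) ∧
      ∀ (Γ₀ : Subgroup (unipDelta L e dV hdV dW hdW))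
        (_ : ∀ u : unipDelta L e dV hdV dW hdW, u ∈ Γ₀ ↔ (u : HA L e dV hdV dW hdW) ∈ ratH L e dV hdV dW hdW ∧
          IsSiegelDelta L e dV hdV dW hdW
            (iotaGG L e dV hdV dW hdW (1, UnitaryGroup.rationalPairToAdelic (Fp L) L (IsCMField.complexConj L) N M (Matrix.diagonal dV) (Matrix.diagonal dW) g₀) *
              (u : HA L e dV hdV dW hdW) *
              (iotaGG L e dV hdV dW hdW (1, UnitaryGroup.rationalPairToAdelic (Fp L) L (IsCMField.complexConj L) N M (Matrix.diagonal dV) (Matrix.diagonal dW) g₀))⁻¹))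
        (β₁ : unipDelta L e dV hdV dW hdW → ℝ≥0∞) (_ : IsCoveringWeight Γ₀ β₁),
        ∀ {χ : HeckeCharacter L} {s : ℂ} {f : HA L e dV hdV dW hdW → ℂ} (_ : IsSiegelDeltaSection L e dV hdV dW hdW χ s f) (_ : Continuous f)
          (S : Matrix (Fin 2) (Fin 2) L)
          (_ : ∀ z : HA L e dV hdV dW hdW, z ∈ unipDelta L e dV hdV dW hdW →
            IsSiegelDelta L e dV hdV dW hdW (iotaGG L e dV hdV dW hdW (1, UnitaryGroup.rationalPairToAdelic (Fp L) L (IsCMField.complexConj L) N M (Matrix.diagonal dV) (Matrix.diagonal dW) g₀) * z * (iotaGG L e dV hdV dW hdW (1, UnitaryGroup.rationalPairToAdelic (Fp L) L (IsCMField.complexConj L) N M (Matrix.diagonal dV) (Matrix.diagonal dW) g₀))⁻¹) →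
            unipDeltaChar L e dV hdV dW hdW S z = 1)
          (h : HA L e dV hdV dW hdW),
          ∫⁻ u, ‖f (iotaGG L e dV hdV dW hdW (1, UnitaryGroup.rationalPairToAdelic (Fp L) L (IsCMField.complexConj L) N M (Matrix.diagonal dV) (Matrix.diagonal dW) g₀) * (u : HA L e dV hdV dW hdW) * h)‖ₑ * β₁ u ∂νN =
            C * ∫⁻ t, ‖f (iotaGG L e dV hdV dW hdW (1, UnitaryGroup.rationalPairToAdelic (Fp L) L (IsCMField.complexConj L) N M (Matrix.diagonal dV) (Matrix.diagonal dW) g₀) * n₂ t * h)‖ₑ ∂μ ∧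
          (Integrable (fun u : unipDelta L e dV hdV dW hdW => (β₁ u).toReal •
              (conj (unipDeltaChar L e dV hdV dW hdW S (u : HA L e dV hdV dW hdW) : ℂ) * f (iotaGG L e dV hdV dW hdW (1, UnitaryGroup.rationalPairToAdelic (Fp L) L (IsCMField.complexConj L) N M (Matrix.diagonal dV) (Matrix.diagonal dW) g₀) * (u : HA L e dV hdV dW hdW) * h))) νN ↔
            Integrable (fun t => conj (unipDeltaChar L e dV hdV dW hdW S (n₂ t) : ℂ) * f (iotaGG L e dV hdV dW hdW (1, UnitaryGroup.rationalPairToAdelic (Fp L) L (IsCMField.complexConj L) N M (Matrix.diagonal dV) (Matrix.diagonal dW) g₀) * n₂ t * h)) μ) ∧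
          ∫ u, (β₁ u).toReal • (conj (unipDeltaChar L e dV hdV dW hdW S (u : HA L e dV hdV dW hdW) : ℂ) * f (iotaGG L e dV hdV dW hdW (1, UnitaryGroup.rationalPairToAdelic (Fp L) L (IsCMField.complexConj L) N M (Matrix.diagonal dV) (Matrix.diagonal dW) g₀) * (u : HA L e dV hdV dW hdW) * h)) ∂νN =
            C.toReal • ∫ t, conj (unipDeltaChar L e dV hdV dW hdW S (n₂ t) : ℂ) * f (iotaGG L e dV hdV dW hdW (1, UnitaryGroup.rationalPairToAdelic (Fp L) L (IsCMField.complexConj L) N M (Matrix.diagonal dV) (Matrix.diagonal dW) g₀) * n₂ t * h) ∂μ := by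
  obtain ⟨n₂, C, hC0, hCtop, hn₂c, hn₂add, hn₂mem, hn₂X, hn₂rat, hmain⟩ :=
    exists_corner_unfold_of_invariant L e dV hdV dW hdW hdV0 hdW0 hg₀ Λ hΛ νN μ
  refine ⟨n₂, C, hC0, hCtop, hn₂c, hn₂add, hn₂mem, hn₂X, hn₂rat, fun Γ₀ hΓ₀ β₁ hβ₁ χ s f hf hfc S hS h => ?_⟩
  have hgg : UnitaryGroup.rationalPairToAdelic (Fp L) L (IsCMField.complexConj L) N M (Matrix.diagonal dV) (Matrix.diagonal dW) g₀ *
      UnitaryGroup.rationalPairToAdelic (Fp L) L (IsCMField.complexConj L) N M (Matrix.diagonal dV) (Matrix.diagonal dW) g₀ = 1 := by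
    rw [← map_mul, mul_self_of_coe_eq_signDiagonal L e dV dW (pattern_std L) hg₀, map_one]
  have hw₀inv := reflStd_inv L e dV hdV dW hdW hg₀
  have hfZ : ∀ z : HA L e dV hdV dW hdW, z ∈ unipDelta L e dV hdV dW hdW →
      IsSiegelDelta L e dV hdV dW hdW (iotaGG L e dV hdV dW hdW (1, UnitaryGroup.rationalPairToAdelic (Fp L) L (IsCMField.complexConj L) N M (Matrix.diagonal dV) (Matrix.diagonal dW) g₀) * z * (iotaGG L e dV hdV dW hdW (1, UnitaryGroup.rationalPairToAdelic (Fp L) L (IsCMField.complexConj L) N M (Matrix.diagonal dV) (Matrix.diagonal dW) g₀))⁻¹) →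
      ∀ x : HA L e dV hdV dW hdW, f (iotaGG L e dV hdV dW hdW (1, UnitaryGroup.rationalPairToAdelic (Fp L) L (IsCMField.complexConj L) N M (Matrix.diagonal dV) (Matrix.diagonal dW) g₀) * (z * x)) =
        f (iotaGG L e dV hdV dW hdW (1, UnitaryGroup.rationalPairToAdelic (Fp L) L (IsCMField.complexConj L) N M (Matrix.diagonal dV) (Matrix.diagonal dW) g₀) * x) := by
    intro z hz hzP x
    have hX := (isSiegelDelta_conj_unip_iff L e dV hdV dW hdW hgg hz).1 (by rw [hw₀inv] at hzP; exact hzP)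
    obtain ⟨hP, hσ⟩ := reflection_stabilizer_data L e dV hdV dW hdW χ s hgg hz hX
    rw [show iotaGG L e dV hdV dW hdW (1, UnitaryGroup.rationalPairToAdelic (Fp L) L (IsCMField.complexConj L) N M (Matrix.diagonal dV) (Matrix.diagonal dW) g₀) * (z * x) =
        iotaGG L e dV hdV dW hdW (1, UnitaryGroup.rationalPairToAdelic (Fp L) L (IsCMField.complexConj L) N M (Matrix.diagonal dV) (Matrix.diagonal dW) g₀) * z *
          (iotaGG L e dV hdV dW hdW (1, UnitaryGroup.rationalPairToAdelic (Fp L) L (IsCMField.complexConj L) N M (Matrix.diagonal dV) (Matrix.diagonal dW) g₀))⁻¹ *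
          (iotaGG L e dV hdV dW hdW (1, UnitaryGroup.rationalPairToAdelic (Fp L) L (IsCMField.complexConj L) N M (Matrix.diagonal dV) (Matrix.diagonal dW) g₀) * x) by group, hf _ hP, hσ, one_mul]
  obtain ⟨hlin, hboch⟩ := hmain Γ₀ hΓ₀ β₁ hβ₁
  refine ⟨?_, ?_⟩
  · -- (i) the twist-free `[0, ∞]` transport
    have h1 := hlin (fun x => ‖f (iotaGG L e dV hdV dW hdW (1, UnitaryGroup.rationalPairToAdelic (Fp L) L (IsCMField.complexConj L) N M (Matrix.diagonal dV) (Matrix.diagonal dW) g₀) * x * h)‖ₑ)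
      (hfc.comp ((continuous_const.mul continuous_subtype_val).mul continuous_const)).measurable.enorm (fun z hz hzP u _ => by
        show ‖f (iotaGG L e dV hdV dW hdW (1, UnitaryGroup.rationalPairToAdelic (Fp L) L (IsCMField.complexConj L) N M (Matrix.diagonal dV) (Matrix.diagonal dW) g₀) * (z * u) * h)‖ₑ =
          ‖f (iotaGG L e dV hdV dW hdW (1, UnitaryGroup.rationalPairToAdelic (Fp L) L (IsCMField.complexConj L) N M (Matrix.diagonal dV) (Matrix.diagonal dW) g₀) * u * h)‖ₑ
        rw [mul_assoc _ (z * u) h, mul_assoc z u h, hfZ z hz hzP, ← mul_assoc])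
    exact (lintegral_congr fun u => mul_comm _ _).trans h1
  · -- (ii) the twisted Bochner unfolding
    refine hboch (fun x => conj (unipDeltaChar L e dV hdV dW hdW S x : ℂ) * f (iotaGG L e dV hdV dW hdW (1, UnitaryGroup.rationalPairToAdelic (Fp L) L (IsCMField.complexConj L) N M (Matrix.diagonal dV) (Matrix.diagonal dW) g₀) * x * h)) ?_ ?_
    · exact ((Complex.continuous_conj.comp (continuous_unipDeltaChar L e dV hdV dW hdW S)).comp continuous_subtype_val).mul
        (hfc.comp ((continuous_const.mul continuous_subtype_val).mul continuous_const))
    · intro z hz hzP u hu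
      show conj (unipDeltaChar L e dV hdV dW hdW S (z * u) : ℂ) * f (iotaGG L e dV hdV dW hdW (1, UnitaryGroup.rationalPairToAdelic (Fp L) L (IsCMField.complexConj L) N M (Matrix.diagonal dV) (Matrix.diagonal dW) g₀) * (z * u) * h) =
        conj (unipDeltaChar L e dV hdV dW hdW S u : ℂ) * f (iotaGG L e dV hdV dW hdW (1, UnitaryGroup.rationalPairToAdelic (Fp L) L (IsCMField.complexConj L) N M (Matrix.diagonal dV) (Matrix.diagonal dW) g₀) * u * h)
      rw [unipDeltaChar_mul L e dV hdV dW hdW S hz hu, hS z hz hzP, one_mul, mul_assoc _ (z * u) h, mul_assoc z u h, hfZ z hz hzP, ← mul_assoc]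

end Summit.HodgeConjecture.HodgeConjecture.Cruxes.HLiu418.K2LiuRankOneUnfolding

end
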